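import Summits.QuantumFields.BalabanUV.Beta.ChartConjugationRelativeEnd

/-!
# `BalabanUV.Beta.ChartConjugationRemainderEnd` — the reflection-covariance END over a relative inverse WITH A TADPOLE-NULL REMAINDER SLOT in the
# second-order law (β sub-cell, row BETA-an2 = BINDER-OWNERS row D1 OWNER, lineage an2 gen 17; DECISION (L4-R), memo `SKELETON-D1-L4.v1` §2–§3 (W-END-REM))

HONEST FRAMING (cell contract, verbatim): «discharging `BetaPertH` makes Bałaban's UV stability UNCONDITIONAL — a real
constructive-QFT result; it is NOT the continuum limit and NOT the Clay problem.»  THIS MODULE mints no `Prop` fact and no `def`,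
cites nothing as a hypothesis, instantiates NO binder of the wall and DISCHARGES NOTHING of it: it re-states an2-g12's relative ENDs
(`ChartConjugationRelativeEnd.hess_refl_conj_rel` / `hessKer_refl_conj_rel` / `axisReflectionCovariant_flip_hessKer_conj_rel` /
`axisReflectionCovariant_flipK_hessKer_conj_rel`) with ONE EXTRA LETTER in the second-order law (Wr-conj): a remainder table `Rm μ y ν y′`
(packed: `Rm α μ y ν y′`) that is localised and has ZERO TADPOLE against the resolvent `A` — the hR twin of the hW END's remainder sockets
(`WardLocusRecursiveEnd`'s `hNr/hNt/hN0`, an1's `KernelWardRemainderParity`).  With `Rm = 0` every statement is the relative END verbatim.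
Every remaining hypothesis is a BINDER.  NOT summit progress; NOT continuum; NOT Clay.

ABSOLUTE RULE (cell, verbatim): «No internally-minted statement may enter as a cited fact. Every hypothesis is either
kernel-proved in this package or a verbatim quotation of a PUBLISHED theorem with page reference. The manuscript(s) under
audit are NOT citable for their own disputed steps — they are the thing under adjudication; programme-internal
(2001/route/tribunal) claims are never citable.»  Every theorem below is kernel-proved from explicit, abstract hypotheses.

WHY (owner decision (L4-R)).  `SecondOrderTransport` + `SecondOrderContactForm/Residual/Assembly` show that for the (L4-D) W-literal with letters of
similarity shape the second-order contact is an5's `conjW 𝕄 V V′ X X′ X₂` PLUS a residual `Δ` that is NOT a `[𝕄, ·]`-contact in general but whose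
TADPOLE against the resolvent is a sum of first-order tadpoles (zero by row parity / reflection symmetry, leaf (W-TAD)).  The END consumes (Wr-conj) only
through an5's `hess_conj_invariant_rel`, i.e. through the tadpole of the contact: a tadpole-null localised remainder passes.

CONTENT.  §1 (generic fibre) `hess_refl_conj_rem_rel`, `hessKer_refl_conj_rem_rel`, **`axisReflectionCovariant_flip_hessKer_conj_rem_rel`**;
§2 (packed fibre) **`axisReflectionCovariant_flipK_hessKer_conj_rem_rel`** — sockets (St), (Wt), (Sr-conj) VERBATIM, (Wr-conj-rem) with `+ Rm α μ y ν y′`,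
`hRmL : Loc (Rm …)`, `hRm0 : tadpole K (Rm …) = 0`.  Provenance: β sub-cell, unit beta-an2 gen 17, 2026-08-20 (v1); proofs = an2-g12's with one
`tadpole_add` more; nothing restated as new mathematics; no existing file touched.
-/

open Finset
open scoped BigOperators
open Literature.MathematicalPhysics.QuantumFieldTheory.Balaban1983to89
open Literature.MathematicalPhysics.QuantumFieldTheory.Balaban1983to89.Beta
open B12Sec2to5 (l1 l1_nonneg)
open ExpKernelCalculus (MKer Decays BiLoc comp tr bubble tadpole hess hessKer hess_eq_hessKer BlockCovariant VertexFamily VertexFamily₂)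
open PolarizationSign (axisReflect axisReflect_apply reflSign AxisReflectionCovariant)
open KernelReflection (LegMap refK refK_apply bondRefl bondRefl_sub comp_refK tr_refK tadpole_smul bubble_smul_left bubble_smul_right)
open AffineAveraging (box toSite)
open OneStepResolventKernel (Fib wsum LocStencil JetData)
open OneStepKernelFamily (KInvStep decays_KInvStep shiftK_KInvStep colH vertexOfK vertexFamily_vertexOfK' TstepOf TbalOf flipK)
open ResolventReflection (bref bref_eq_bondRefl Φ refK_KInvStep vertexOfK_translate_block)
open Summit.QuantumFields.BalabanUV.Beta.TameKernelCalculus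
open Summit.QuantumFields.BalabanUV.Beta.ChartConjugation
open Summit.QuantumFields.BalabanUV.Beta.ChartConjugationReflection
open Summit.QuantumFields.BalabanUV.Beta.ChartConjugationRelative
open Summit.QuantumFields.BalabanUV.Beta.ChartConjugationRelativeEnd (comp_vertexOfK_comm)

namespace Summit.QuantumFields.BalabanUV.Beta.ChartConjugationRemainderEnd

noncomputable section

/-! ## §1 Covariance of the resolvent Hessian under conjugated vertex laws with a tadpole-null remainder — relative inverse -/

section General

variable {D : ℕ} {F : Type*} [Fintype F]

/-- **COVARIANCE OF THE RESOLVENT HESSIAN, CONJUGATED VERTEX LAWS WITH REMAINDER, RELATIVE INVERSE**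
(`ChartConjugationRelativeEnd.hess_refl_conj_rel` with the extra letter `Rm μ y ν y′`: localised, `tadpole A (Rm …) = 0`). -/
theorem hess_refl_conj_rem_rel (Φ : LegMap D F) {A M E : MKer D F} {V : Fin D → (Fin D → ℤ) → MKer D F}
    {W : Fin D → (Fin D → ℤ) → Fin D → (Fin D → ℤ) → MKer D F} (hA : Spr A) (hM : Spr M) (hE : Spr E) (hR : RelInv A M E)
    (hAr : refK Φ A = A) (hV : ∀ μ y, Loc (V μ y)) (hW : ∀ μ y ν y', Loc (W μ y ν y'))
    (ρ : Fin D → (Fin D → ℤ) → (Fin D → ℤ)) (σ : Fin D → ℝ) {X : Fin D → (Fin D → ℤ) → MKer D F}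
    {X₂ Rm : Fin D → (Fin D → ℤ) → Fin D → (Fin D → ℤ) → MKer D F} (hX : ∀ μ y, Loc (X μ y)) (hX₂ : ∀ μ y ν y', Loc (X₂ μ y ν y'))
    (hEX : ∀ μ y, comp E (X μ y) = comp (X μ y) E) (hEX₂ : ∀ μ y ν y', comp E (X₂ μ y ν y') = comp (X₂ μ y ν y') E)
    (hRmL : ∀ μ y ν y', Loc (Rm μ y ν y')) (hRm0 : ∀ μ y ν y', tadpole A (Rm μ y ν y') = 0)
    (hVr : ∀ μ y, V μ (ρ μ y) = σ μ • refK Φ (V μ y + conjV M (X μ y)))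
    (hWr : ∀ μ y ν y', W μ (ρ μ y) ν (ρ ν y') =
      (σ μ * σ ν) • refK Φ (W μ y ν y' + conjW M (V μ y) (V ν y') (X μ y) (X ν y') (X₂ μ y ν y') + Rm μ y ν y'))
    (μ : Fin D) (y : Fin D → ℤ) (ν : Fin D) (y' : Fin D → ℤ) :
    hess A V W μ (ρ μ y) ν (ρ ν y') = σ μ * σ ν * hess A V W μ y ν y' := by
  have key := hess_conj_invariant_rel hA hM hE hR (hV μ y) (hV ν y') (hW μ y ν y') (hX μ y) (hX ν y') (hX₂ μ y ν y')
    (hEX μ y) (hEX ν y') (hEX₂ μ y ν y')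
  have hWc : Loc (W μ y ν y' + conjW M (V μ y) (V ν y') (X μ y) (X ν y') (X₂ μ y ν y')) :=
    (hW μ y ν y').add (loc_conjW hM (hV μ y) (hV ν y') (hX μ y) (hX ν y') (hX₂ μ y ν y'))
  have hW' : Loc (W μ y ν y' + conjW M (V μ y) (V ν y') (X μ y) (X ν y') (X₂ μ y ν y') + Rm μ y ν y') := hWc.add (hRmL μ y ν y')
  have hV₁ : Loc (V μ y + conjV M (X μ y)) := (hV μ y).add (loc_conjV hM (hX μ y))
  have hV₂ : Loc (V ν y' + conjV M (X ν y')) := (hV ν y').add (loc_conjV hM (hX ν y'))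
  unfold ExpKernelCalculus.hess
  rw [hWr, hVr, hVr, tadpole_smul, bubble_smul_left, bubble_smul_right]
  conv_lhs => rw [← hAr]
  rw [tadpole_refK_loc Φ hA hW', bubble_refK_loc Φ hA hV₁ hV₂, tadpole_add hA hWc (hRmL μ y ν y'), hRm0, add_zero]
  linear_combination (σ μ * σ ν) * key

open B6BondElimination (unitVec unitVec_apply) in
/-- **THE DIFFERENCE-VARIABLE LAW, CONJUGATED VERTEX LAWS WITH REMAINDER, RELATIVE INVERSE**
(`ChartConjugationRelativeEnd.hessKer_refl_conj_rel` twin). -/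
theorem hessKer_refl_conj_rem_rel (Φ : LegMap D F) {A M E : MKer D F} {V : Fin D → (Fin D → ℤ) → MKer D F}
    {W : Fin D → (Fin D → ℤ) → Fin D → (Fin D → ℤ) → MKer D F} {N : ℕ} (hA : Spr A) (hM : Spr M) (hE : Spr E)
    (hR : RelInv A M E) (hcov : BlockCovariant A V W N) (hAr : refK Φ A = A) (hV : ∀ μ y, Loc (V μ y))
    (hW : ∀ μ y ν y', Loc (W μ y ν y')) (α : Fin D) (c : ℤ) {X : Fin D → (Fin D → ℤ) → MKer D F}
    {X₂ Rm : Fin D → (Fin D → ℤ) → Fin D → (Fin D → ℤ) → MKer D F} (hX : ∀ μ y, Loc (X μ y)) (hX₂ : ∀ μ y ν y', Loc (X₂ μ y ν y'))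
    (hEX : ∀ μ y, comp E (X μ y) = comp (X μ y) E) (hEX₂ : ∀ μ y ν y', comp E (X₂ μ y ν y') = comp (X₂ μ y ν y') E)
    (hRmL : ∀ μ y ν y', Loc (Rm μ y ν y')) (hRm0 : ∀ μ y ν y', tadpole A (Rm μ y ν y') = 0)
    (hVr : ∀ μ y, V μ (bondRefl α c μ y) = reflSign α μ • refK Φ (V μ y + conjV M (X μ y)))
    (hWr : ∀ μ y ν y', W μ (bondRefl α c μ y) ν (bondRefl α c ν y') =
      (reflSign α μ * reflSign α ν) • refK Φ (W μ y ν y' + conjW M (V μ y) (V ν y') (X μ y) (X ν y') (X₂ μ y ν y') + Rm μ y ν y'))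
    (μ ν : Fin D) (z : Fin D → ℤ) :
    hessKer A V W μ ν (axisReflect α z + (if μ = α then unitVec α else 0) - (if ν = α then unitVec α else 0))
      = reflSign α μ * reflSign α ν * hessKer A V W μ ν z := by
  have h := hess_refl_conj_rem_rel Φ hA hM hE hR hAr hV hW (bondRefl α c) (reflSign α) hX hX₂ hEX hEX₂ hRmL hRm0 hVr hWr μ 0 ν z
  rw [hess_eq_hessKer hcov, hess_eq_hessKer hcov, sub_zero, bondRefl_sub, sub_zero] at h
  exact h

open B6BondElimination (unitVec unitVec_apply) in
/-- **`AxisReflectionCovariant` OF THE FLIPPED KERNEL FROM THE CONJUGATED VERTEX LAWS WITH REMAINDER, RELATIVE INVERSE**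
(`ChartConjugationRelativeEnd.axisReflectionCovariant_flip_hessKer_conj_rel` twin): per axis, a leg map fixing `A`, an offset, localised contact
families `X`, `X₂` COMMUTING WITH `E`, a localised remainder `Rm` with ZERO TADPOLE against `A`, and (Sr-conj)/(Wr-conj-rem). -/
theorem axisReflectionCovariant_flip_hessKer_conj_rem_rel {A M E : MKer D F} {V : Fin D → (Fin D → ℤ) → MKer D F}
    {W : Fin D → (Fin D → ℤ) → Fin D → (Fin D → ℤ) → MKer D F} {N : ℕ} (hA : Spr A) (hM : Spr M) (hE : Spr E)
    (hR : RelInv A M E) (hcov : BlockCovariant A V W N) (hV : ∀ μ y, Loc (V μ y)) (hW : ∀ μ y ν y', Loc (W μ y ν y'))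
    (hAr : ∀ α : Fin D, ∃ Φα : LegMap D F, refK Φα A = A ∧ ∃ (c : ℤ) (X : Fin D → (Fin D → ℤ) → MKer D F)
      (X₂ Rm : Fin D → (Fin D → ℤ) → Fin D → (Fin D → ℤ) → MKer D F), (∀ μ y, Loc (X μ y)) ∧ (∀ μ y ν y', Loc (X₂ μ y ν y')) ∧
      (∀ μ y, comp E (X μ y) = comp (X μ y) E) ∧ (∀ μ y ν y', comp E (X₂ μ y ν y') = comp (X₂ μ y ν y') E) ∧
      (∀ μ y ν y', Loc (Rm μ y ν y')) ∧ (∀ μ y ν y', tadpole A (Rm μ y ν y') = 0) ∧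
      (∀ μ y, V μ (bondRefl α c μ y) = reflSign α μ • refK Φα (V μ y + conjV M (X μ y))) ∧
      (∀ μ y ν y', W μ (bondRefl α c μ y) ν (bondRefl α c ν y') =
        (reflSign α μ * reflSign α ν) • refK Φα (W μ y ν y' + conjW M (V μ y) (V ν y') (X μ y) (X ν y') (X₂ μ y ν y') + Rm μ y ν y'))) :
    AxisReflectionCovariant (fun μ ν z => hessKer A V W μ ν (-z)) := by
  intro α μ ν z
  obtain ⟨Φα, hA', c, X, X₂, Rm, hX, hX₂, hEX, hEX₂, hRmL, hRm0, hVr, hWr⟩ := hAr α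
  have h := hessKer_refl_conj_rem_rel Φα hA hM hE hR hcov hA' hV hW α c hX hX₂ hEX hEX₂ hRmL hRm0 hVr hWr μ ν (-z)
  have e : -(axisReflect α z - (if μ = α then unitVec α else 0) + (if ν = α then unitVec α else 0))
      = axisReflect α (-z) + (if μ = α then unitVec α else 0) - (if ν = α then unitVec α else 0) := by
    funext i
    simp only [Pi.neg_apply, Pi.sub_apply, Pi.add_apply, axisReflect_apply]
    by_cases hi : i = α <;> by_cases hμ : μ = α <;> by_cases hν : ν = α <;> simp [hi, hμ, hν, unitVec_apply] <;> ring
  show hessKer A V W μ ν (-(axisReflect α z - (if μ = α then unitVec α else 0) + (if ν = α then unitVec α else 0)))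
    = reflSign α μ * reflSign α ν * hessKer A V W μ ν (-z)
  rw [e]
  exact h

end General

/-! ## §2 The packed level: the `hR` END over the relative sockets, with the remainder slot -/

section Packed

variable {d N : ℕ}

/-- **THE TYPED REFLECTION LAW OF A RESOLVENT HESSIAN KERNEL FROM CONJUGATED JET COVARIANCE WITH REMAINDER — RELATIVE INVERSE.**
`ChartConjugationRelativeEnd.axisReflectionCovariant_flipK_hessKer_conj_rel` with (Wr-conj) carrying the extra remainder `+ Rm α μ y ν y′`, localised
(`hRmL`) and of zero tadpole against `K` (`hRm0`).  All covariances and inverse rules are HYPOTHESES, never facts. -/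
theorem axisReflectionCovariant_flipK_hessKer_conj_rem_rel {K M E : MKer (d + 1) (Fib d)}
    (hKd : ∃ δ C : ℝ, 0 < δ ∧ 0 ≤ C ∧ Decays K C δ) (hKs : ∀ t : Fin (d + 1) → ℤ, ExpKernelCalculus.shiftK (-((N : ℤ) • t)) K = K)
    (hKr : ∀ α : Fin (d + 1), refK (Φ N α) K = K) (hM : Spr M) (hE : Spr E) (hR : RelInv K M E) (J : JetData d N)
    (hSt : ∀ (κ' : Fin (d + 1)) (u t : Fin (d + 1) → ℤ), J.S κ' (u + (N : ℤ) • t) = ExpKernelCalculus.shiftK (-((N : ℤ) • t)) (J.S κ' u))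
    (hWt : ∀ (μ : Fin (d + 1)) (y : Fin (d + 1) → ℤ) (ν : Fin (d + 1)) (y' t : Fin (d + 1) → ℤ),
      J.W μ (y + t) ν (y' + t) = ExpKernelCalculus.shiftK (-((N : ℤ) • t)) (J.W μ y ν y'))
    (C : Fin (d + 1) → Fin (d + 1) → (Fin (d + 1) → ℤ) → MKer (d + 1) (Fib d)) {Cc δc : ℝ} (hC : ∀ α, LocStencil (C α) Cc δc)
    (hδc : 0 < δc) (X₂ Rm : Fin (d + 1) → Fin (d + 1) → (Fin (d + 1) → ℤ) → Fin (d + 1) → (Fin (d + 1) → ℤ) → MKer (d + 1) (Fib d))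
    (hX₂ : ∀ α μ y ν y', Loc (X₂ α μ y ν y'))
    (hEC : ∀ α κ' u, comp E (C α κ' u) = comp (C α κ' u) E)
    (hEX₂ : ∀ α μ y ν y', comp E (X₂ α μ y ν y') = comp (X₂ α μ y ν y') E)
    (hRmL : ∀ α μ y ν y', Loc (Rm α μ y ν y')) (hRm0 : ∀ α μ y ν y', tadpole K (Rm α μ y ν y') = 0)
    (hSrC : ∀ (α κ' : Fin (d + 1)) (u : Fin (d + 1) → ℤ),
      J.S κ' (bref α κ' u) = reflSign α κ' • refK (Φ N α) (J.S κ' u + conjV M (C α κ' u)))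
    (hWrC : ∀ (α μ : Fin (d + 1)) (y : Fin (d + 1) → ℤ) (ν : Fin (d + 1)) (y' : Fin (d + 1) → ℤ),
      J.W μ (bref α μ y) ν (bref α ν y') = (reflSign α μ * reflSign α ν) • refK (Φ N α) (J.W μ y ν y' +
        conjW M (vertexOfK K N J.S μ y) (vertexOfK K N J.S ν y') (vertexOfK K N (C α) μ y) (vertexOfK K N (C α) ν y')
          (X₂ α μ y ν y') + Rm α μ y ν y')) :
    AxisReflectionCovariant (flipK (hessKer K (vertexOfK K N J.S) J.W)) := by
  obtain ⟨Cv, δv, hδv, hV⟩ := vertexFamily_vertexOfK' (N := N) hKd J.loc J.δ_pos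
  have hKspr : Spr K := by obtain ⟨δK, CK, hδK, _, hK⟩ := hKd; exact ⟨CK, δK, hδK, hK⟩
  have hVl : ∀ μ y, Loc (vertexOfK K N J.S μ y) := fun μ y => ⟨_, _, Cv, δv, hδv, hV μ y⟩
  have hWl : ∀ μ y ν y', Loc (J.W μ y ν y') := fun μ y ν y' => ⟨_, _, J.Cw, J.δ, J.δ_pos, J.loc₂ μ y ν y'⟩
  have hcov : BlockCovariant K (vertexOfK K N J.S) J.W N := ⟨hKs, vertexOfK_translate_block hKs hSt, hWt⟩
  refine axisReflectionCovariant_flip_hessKer_conj_rem_rel hKspr hM hE hR hcov hVl hWl fun α => ⟨Φ N α, hKr α, 1, vertexOfK K N (C α),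
    X₂ α, Rm α, fun μ y => ?_, hX₂ α, fun μ y => ?_, hEX₂ α, hRmL α, hRm0 α, fun μ y => ?_, fun μ y ν y' => ?_⟩
  · obtain ⟨Cx, δx, hδx, hXv⟩ := vertexFamily_vertexOfK' (N := N) hKd (hC α) hδc
    exact ⟨_, _, Cx, δx, hδx, hXv μ y⟩
  · exact comp_vertexOfK_comm hKd hE (hC α) hδc (hEC α) μ y
  · rw [← bref_eq_bondRefl]
    exact vertexOfK_reflect_conj (hKr α) hKd hM J.loc J.δ_pos (hC α) hδc (hSrC α) μ y
  · rw [← bref_eq_bondRefl, ← bref_eq_bondRefl]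
    exact hWrC α μ y ν y'

end Packed

end

end Summit.QuantumFields.BalabanUV.Beta.ChartConjugationRemainderEnd
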